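import Mathlib.RingTheory.AdicCompletion.AsTensorProduct
import Mathlib.RingTheory.Henselian
import Mathlib.RingTheory.Artinian.Module
import Mathlib.RingTheory.LocalRing.Basic
import Mathlib.RingTheory.Finiteness.Basic
import Mathlib.RingTheory.Nilpotent.Basic
import HarnessLib

/-!
# Finite algebras over complete local rings: completeness, lifting of idempotents, locality

Topic: `Literature/AlgebraicGeometry/Resolution`. Three classical facts about a module-finite
algebra `B` over an `I`-adically complete Noetherian ring `A`, PROVED over Mathlib:

* `isAdicComplete_of_finite` — **Matsumura, Thm. 8.7**: "Let `A` be a Noetherian ring, `I` an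
  ideal, and `M` a finite `A`-module. … `M ⊗_A Â ≃ M̂`. Hence if `A` is `I`-adically complete, so is
  `M`." (Mathlib has the isomorphism `Â ⊗ M ≅ M̂`, `AdicCompletion.ofTensorProduct_bijective_of_finite_of_isNoetherian`;
  we draw the stated consequence.) [cite: Matsumura1987, Thm. 8.7]
* `isAdicComplete_map_of_finite` — the same completeness for the ring `B` with respect to the
  extended ideal `IB`.
* `isLocalRing_of_isDomain_of_finite_of_isAdicComplete` — **a domain which is module-finite over a
  complete Noetherian local ring `(A, 𝔪)` is a local ring** (the case of Matsumura, Thm. 8.15 /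
  Eisenbud, Cor. 7.6 that is needed for the normalization of complete one-dimensional local domains,
  K–V II (3.17)–(3.18)): `B` is `𝔪B`-adically complete, hence Henselian (Mathlib), so idempotents of
  the Artinian ring `B/𝔪B` lift to `B` and are trivial; an Artinian ring without non-trivial
  idempotents has `s` or `1 - s` a unit for every `s`, and units lift from `B/𝔪B` to `B` because
  `𝔪B` lies in the Jacobson radical. [cite: Matsumura1987, Thm. 8.15]
-/

noncomputable section

open IsLocalRing Polynomial TensorProduct

namespace Literature.AlgebraicGeometry.Resolution

universe u v

/-! ## Matsumura 8.7: finite modules over complete rings are complete -/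

section Complete

variable {A : Type u} [CommRing A] [IsNoetherianRing A] (I : Ideal A) [IsAdicComplete I A]
  (M : Type u) [AddCommGroup M] [Module A M] [Module.Finite A M]

/-- **Matsumura, Thm. 8.7**: a finite module over an `I`-adically complete Noetherian ring is
`I`-adically complete (`M → M̂` is `M ≅ Â ⊗ M ≅ M̂`). [cite: Matsumura1987, Thm. 8.7] -/
theorem isAdicComplete_of_finite : IsAdicComplete I M := by
  rw [← AdicCompletion.of_bijective_iff]
  let E : M ≃ₗ[A] AdicCompletion I A ⊗[A] M :=
    (TensorProduct.lid A M).symm.trans ((AdicCompletion.ofLinearEquiv I A).rTensor M)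
  have hE : ∀ x : M, E x = (1 : AdicCompletion I A) ⊗ₜ x := by
    intro x
    change (AdicCompletion.ofLinearEquiv I A).rTensor M ((TensorProduct.lid A M).symm x) = _
    rw [TensorProduct.lid_symm_apply, LinearEquiv.rTensor_tmul]
    have h1 : (AdicCompletion.ofLinearEquiv I A) 1 = 1 := by
      change AdicCompletion.of I A 1 = 1
      exact (AdicCompletion.algebraMap_apply (I := I) (R := A) (S := A) 1).symm.trans (map_one _)
    rw [h1]
  have hcomp : (AdicCompletion.of I M : M → AdicCompletion I M) =
      (AdicCompletion.ofTensorProduct I M) ∘ E := by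
    funext x
    rw [Function.comp_apply, hE, AdicCompletion.ofTensorProduct_tmul, one_smul]
  rw [hcomp]
  exact (AdicCompletion.ofTensorProduct_bijective_of_finite_of_isNoetherian I M).comp E.bijective

end Complete

section CompleteRing

variable (A : Type u) (B : Type u) [CommRing A] [IsNoetherianRing A] (I : Ideal A)
  [IsAdicComplete I A] [CommRing B] [Algebra A B] [Module.Finite A B]

omit [IsNoetherianRing A] [IsAdicComplete I A] [Module.Finite A B] in
/-- The `B`-ideal filtration `(IB)ⁿ` and the `A`-module filtration `IⁿB` agree. [folklore] -/
theorem mem_map_pow_smul_top_iff (n : ℕ) (x : B) :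
    x ∈ ((I.map (algebraMap A B)) ^ n • ⊤ : Submodule B B) ↔ x ∈ (I ^ n • ⊤ : Submodule A B) := by
  rw [Ideal.smul_top_eq_map (I ^ n), Ideal.map_pow, smul_eq_mul, Ideal.mul_top]
  rfl

/-- **A module-finite algebra over an `I`-adically complete Noetherian ring is `IB`-adically
complete.** [cite: Matsumura1987, Thm. 8.7] -/
theorem isAdicComplete_map_of_finite : IsAdicComplete (I.map (algebraMap A B)) B := by
  haveI : IsAdicComplete I B := isAdicComplete_of_finite I B
  haveI h1 : IsHausdorff (I.map (algebraMap A B)) B := ⟨fun x hx => by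
    refine IsHausdorff.haus' (I := I) x fun n => ?_
    have := hx n
    rw [SModEq.zero] at this ⊢
    exact (mem_map_pow_smul_top_iff A B I n x).mp this⟩
  haveI h2 : IsPrecomplete (I.map (algebraMap A B)) B := ⟨fun f hf => by
    obtain ⟨L, hL⟩ := IsPrecomplete.prec' (I := I) (M := B) (f := f) fun hmn => by
      have := hf hmn
      rw [SModEq.sub_mem] at this ⊢
      exact (mem_map_pow_smul_top_iff A B I _ _).mp this
    exact ⟨L, fun n => by
      have := hL n
      rw [SModEq.sub_mem] at this ⊢
      exact (mem_map_pow_smul_top_iff A B I _ _).mpr this⟩⟩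
  exact { toIsHausdorff := h1, toIsPrecomplete := h2 }

end CompleteRing

/-! ## Idempotents and locality -/

section Local

/-- In a Henselian pair `(B, J)` with `B` a domain, idempotents modulo `J` are trivial: an
idempotent of `B/J` lifts along `X(X-1)` (whose derivative `2X-1` squares to `1` modulo `J` at an
idempotent) to an idempotent of `B`, i.e. to `0` or `1`. [folklore] -/
theorem quotient_idempotent_trivial {B : Type v} [CommRing B] [IsDomain B] (J : Ideal B)
    [HenselianRing B J] (e : B ⧸ J) (he : IsIdempotentElem e) : e = 0 ∨ e = 1 := by
  obtain ⟨a₀, rfl⟩ := Ideal.Quotient.mk_surjective e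
  set f : B[X] := X * (X - C 1) with hf
  have hfm : f.Monic := monic_X.mul (monic_X_sub_C 1)
  have heval : ∀ b : B, f.eval b = b * (b - 1) := fun b => by simp [hf]
  have hder : ∀ b : B, f.derivative.eval b = 2 * b - 1 := fun b => by
    simp only [hf, derivative_mul, derivative_X, one_mul, derivative_sub, derivative_C, sub_zero,
      mul_one, eval_add, eval_sub, eval_X, eval_C]
    ring
  have h0 : f.eval a₀ ∈ J := by
    rw [heval, ← Ideal.Quotient.eq_zero_iff_mem, map_mul, map_sub, map_one]
    have : Ideal.Quotient.mk J a₀ * Ideal.Quotient.mk J a₀ = Ideal.Quotient.mk J a₀ := he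
    rw [mul_sub, mul_one, this, sub_self]
  have h1 : IsUnit (Ideal.Quotient.mk J (f.derivative.eval a₀)) := by
    rw [hder]
    refine IsUnit.of_mul_eq_one (Ideal.Quotient.mk J (2 * a₀ - 1)) ?_
    rw [← map_mul]
    have : (2 * a₀ - 1) * (2 * a₀ - 1) = 4 * (a₀ * (a₀ - 1)) + 1 := by ring
    rw [this, map_add, map_mul, map_one, ← heval, Ideal.Quotient.eq_zero_iff_mem.mpr h0, mul_zero,
      zero_add]
  obtain ⟨a, ha, haa₀⟩ := HenselianRing.is_henselian f hfm a₀ h0 h1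
  have ha' : a * (a - 1) = 0 := by rw [← heval]; exact ha
  have hq : Ideal.Quotient.mk J a₀ = Ideal.Quotient.mk J a := by
    rw [eq_comm, Ideal.Quotient.eq]; exact haa₀
  rcases mul_eq_zero.mp ha' with h | h
  · left; rw [hq, h, map_zero]
  · right; rw [hq, sub_eq_zero.mp h, map_one]

/-- In an Artinian commutative ring without non-trivial idempotents, every element `s` has `s`
or `1 - s` a unit (`sⁿ⁺¹ t = sⁿ` for some `n`, `t`; then `sⁿtⁿ` is idempotent). [folklore] -/
theorem isUnit_or_isUnit_one_sub_of_isArtinianRing {S : Type v} [CommRing S] [IsArtinianRing S]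
    (hid : ∀ e : S, IsIdempotentElem e → e = 0 ∨ e = 1) (s : S) : IsUnit s ∨ IsUnit (1 - s) := by
  obtain ⟨n, t, ht⟩ := IsArtinian.exists_pow_succ_smul_dvd (M := S) s 1
  simp only [smul_eq_mul, mul_one, Nat.succ_eq_add_one] at ht
  -- `s^n = s^(2n) t^n`
  have hiter : ∀ k : ℕ, s ^ n = s ^ (n + k) * t ^ k := by
    intro k
    induction k with
    | zero => rw [add_zero, pow_zero, mul_one]
    | succ k ih =>
      calc s ^ n = s ^ (n + k) * t ^ k := ih
        _ = s ^ k * s ^ n * t ^ k := by rw [pow_add, mul_comm (s ^ n)]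
        _ = s ^ k * (s ^ (n + 1) * t) * t ^ k := by rw [ht]
        _ = s ^ (n + (k + 1)) * t ^ (k + 1) := by ring
  have he : IsIdempotentElem (s ^ n * t ^ n) := by
    change s ^ n * t ^ n * (s ^ n * t ^ n) = s ^ n * t ^ n
    calc s ^ n * t ^ n * (s ^ n * t ^ n) = (s ^ (n + n) * t ^ n) * t ^ n := by rw [pow_add]; ring
      _ = s ^ n * t ^ n := by rw [← hiter n]
  rcases hid _ he with h | h
  · -- `s` is nilpotent
    right
    apply IsNilpotent.isUnit_one_sub
    refine ⟨n, ?_⟩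
    rw [hiter n, pow_add, mul_assoc, h, mul_zero]
  · left
    exact IsUnit.of_mul_eq_one (s ^ n * t ^ (n + 1)) (by
      calc s * (s ^ n * t ^ (n + 1)) = s ^ (n + 1) * t * t ^ n := by ring
        _ = s ^ n * t ^ n := by rw [ht]
        _ = 1 := h)

/-- **A domain which is module-finite over a complete Noetherian local ring is local**
(Matsumura, Thm. 8.15 / Eisenbud, Cor. 7.6, the case of a domain): with `J = 𝔪B`, `B` is
`J`-adically complete hence Henselian, `B/J` is Artinian with only trivial idempotents, so every
`b ∈ B` has `b` or `1-b` a unit modulo `J`, and `J ⊆ rad B`. [cite: Matsumura1987, Thm. 8.15] -/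
theorem isLocalRing_of_isDomain_of_finite_of_isAdicComplete (A : Type u) (B : Type u) [CommRing A]
    [IsLocalRing A] [IsNoetherianRing A] [IsAdicComplete (maximalIdeal A) A] [CommRing B]
    [IsDomain B] [Algebra A B] [Module.Finite A B] : IsLocalRing B := by
  set J : Ideal B := (maximalIdeal A).map (algebraMap A B) with hJ
  haveI : IsAdicComplete J B := isAdicComplete_map_of_finite A B (maximalIdeal A)
  have hjac : J ≤ (⊥ : Ideal B).jacobson := IsAdicComplete.le_jacobson_bot J
  -- `B/J` is an Artinian ring with trivial idempotents
  letI : Field (A ⧸ maximalIdeal A) := Ideal.Quotient.field _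
  haveI : Module.Finite A (B ⧸ J) := inferInstance
  haveI : Module.Finite (A ⧸ maximalIdeal A) (B ⧸ J) :=
    Module.Finite.of_restrictScalars_finite A (A ⧸ maximalIdeal A) (B ⧸ J)
  haveI : IsArtinianRing (B ⧸ J) := IsArtinianRing.of_finite (A ⧸ maximalIdeal A) (B ⧸ J)
  have hid := quotient_idempotent_trivial J
  -- units lift from `B/J`
  have hlift : ∀ b : B, IsUnit (Ideal.Quotient.mk J b) → IsUnit b := by
    intro b hb
    obtain ⟨v, hv⟩ := hb.exists_right_inv
    obtain ⟨v, rfl⟩ := Ideal.Quotient.mk_surjective v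
    rw [← map_mul, ← map_one (Ideal.Quotient.mk J), Ideal.Quotient.eq] at hv
    have hu : IsUnit (b * v) := by
      have := Ideal.mem_jacobson_bot.mp (hjac hv) 1
      rwa [mul_one, sub_add_cancel] at this
    exact isUnit_of_mul_isUnit_left hu
  refine IsLocalRing.of_isUnit_or_isUnit_one_sub_self fun b => ?_
  rcases isUnit_or_isUnit_one_sub_of_isArtinianRing hid (Ideal.Quotient.mk J b) with h | h
  · exact Or.inl (hlift b h)
  · refine Or.inr (hlift (1 - b) ?_)
    rwa [map_sub, map_one]

end Local

end Literature.AlgebraicGeometry.Resolution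

end
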